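import Mathlib.Analysis.Analytic.Order
import Mathlib.NumberTheory.LSeries.DirichletContinuation
import Literature.NumberTheory.LFunctions.UniformClassGroupPNT
import HarnessLib

/-!
# Conrey–Iwaniec (2020): critical simple zeros of lacunary `L`-functions — Theorem 2.1

LABEL (cell `landau-siegel`, §C literature harvest, topic r5; bears_on F-S3 §C): a Levinson–Conrey
critical-zero count for the class group `L`-functions of a quadratic field, UNCONDITIONAL but
meaningful only in the "exceptional world" `L(1, χ) log|D| → 0`. Nothing here assumes or concludes
anything about the existence of exceptional characters. «The programme SEARCHES and TYPES; no claim
about Landau–Siegel zeros, Theorems 1–2 of arXiv:2211.02515 or a repaired Margin232 until a kernel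
theorem says so.»

Topic `Literature/NumberTheory/LFunctions` (namespace `Literature.NumberTheory.LFunctions`; the
paper's counting functions live in the sub-namespace `ConreyIwaniec2020`). STATEMENT LAYER: ONE named
fact (D-0014; `def … : Prop`, not proved here) — Theorem 2.1 — plus real definitions (the dyadic
zero counts `N(T)`, `N₀₀(T)` of a function `L : ℂ → ℂ`, and the paper's "`ε`-exceptional"
predicate, Definition 1.1) with proved API lemmas. Companion to `ConreyIwaniec2002.lean` (the 2002
paper of the same authors, whose §4 convolution-sum technology this paper re-uses for its
off-diagonal terms).

## What the source prints (held text `paper:arxiv-1607.03288`, corpus-tex, 31 chunks, read 2026-08-26)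

J. B. Conrey, H. Iwaniec, *Critical zeros of lacunary `L`-functions*, Acta Arith. **195** (2020)
217–268 = arXiv:1607.03288 [ConreyIwaniec2020].

**§1, standing data** (chunk p0002). `K = ℚ(√D)` of discriminant `D`, `ψ : Cl(K) → ℂ` a class
group character, `L(s, ψ) = Σ_𝔞 ψ(𝔞) (N𝔞)^{−s}`, `Q = √|D|/2π`; `χ (mod |D|)` "the Dirichlet real
character (given by the Kronecker symbol associated with the field `K = ℚ(√D)`)", so that
`L(s, ψ₀) = ζ(s) L(s, χ)` for the trivial class group character `ψ₀`. **Definition 1.1**: "We say that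
the character `χ (mod |D|)` is `ε`-exceptional if `L(1, χ) log|D| ≤ ε`."

**§2** (chunk p0003). "Let `N(T)` denote the number of zeros `ρ = β + iγ` of `L(s)` (counted with
multiplicity) in the rectangle `0 < β < 1`, `γ ∼ T`" [`γ ∼ T` means `T < γ ≤ 2T`, §1 end] …

> **Theorem 2.1.** Let `N₀₀(T)` denote the number of simple zeros `ρ = ½ + iγ` of `L(s, ψ)` with
> `γ ∼ T` and `N(T)` the number of all zeros `ρ = β + iγ` of `L(s, ψ)` with `0 < β < 1`, `γ ∼ T`
> counted with multiplicity. We have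
> `N₀₀(T) = N(T) + O(T log|D| + (L(1, χ) log T)^{1/4} T log T)`   (2.2)
> where the implied constant is absolute. Putting `ε = ε(D) = L(1, χ) log|D|` we get
> `N₀₀(T) = {1 + O(δ)} N(T)`   (2.3)
> with any `δ ≥ ε^{1/5}` and every `T` with `|D|^{1/δ} ≤ T ≤ |D|^{δ⁴/ε}`, where the implied constant
> is absolute.

"Remarks. First of all, the approximate formulas (2.2) and (2.3) are unconditional, but of course,
(2.3) is meaningful only if `ε = ε(D)` is sufficiently small." Corollaries 2.3/2.4: over an
"exceptional" sequence of discriminants (`ε(D) → 0`, Definition 2.2) 100 % of the zeros of every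
`L(s, ψ)` — in particular of `ζ(s)` — at height `∼ T`, `|D|^{−log ε} ≤ T ≤ |D|^{−1/(ε log ε)}`, are
simple and critical; "the arguments … extend easily to `L(s, χ′) L(s, χχ′)`" (p0003). Proof: Levinson's
method in Conrey's form with `G = L + L′/log N`, mollifier of length `M = T^{1/400}` (§12), the
lower bound (12.1) `N₀₀(T) > N(T) − 4|𝒦^≠|^{1/2} T log T + O(T log Q + T (log T)(L(1,χ) log T)^{1/4})`,
and §§13–24 for the off-diagonal `𝒦^≠` («the condition `T ≥ Q^{3200}` is no longer required,
because the estimate (12.1) holds trivially otherwise», §12).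

## Lean rendering / design choices (audit notes for ls-lit-ref)

* `K = ℚ(√D)`: any number field `K : Type` with `finrank ℚ K = 2`; `D = NumberField.discr K` (the
  field discriminant, both signs allowed as in the paper). `ψ` is `ψ : ClassGroup (𝓞 K) →* ℂˣ` and
  `L(s, ψ)` is the tree's `NumberField.classGroupLFunction K ψ` (`UniformClassGroupPNT.lean`;
  `= ζ_K` for `ψ = 1` off `s = 1`).
* "the Kronecker character `χ (mod |D|)`": rendered, exactly as in the tree's
  `QuadraticDedekindZetaZeros.exists_kroneckerChar` / `dedekindZetaCont_eq_riemannZeta_mul_LFunction`,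
  as a Dirichlet character `κ` modulo `M = |D|` with `κ ≠ 1` and `ζ_K(s) = ζ(s) L(s, κ)` on
  `Re s > 1` (this determines `κ`); `L(1, χ) > 0` enters as `‖κ.LFunction 1‖` (Mathlib's continued
  `L`-function; for the real character the norm is the value).
* `N(T)`, `N₀₀(T)`: `ConreyIwaniec2020.dyadicZeroCount L T` (zeros with `0 < Re s < 1`,
  `T < Im s ≤ 2T`, weighted by `analyticOrderNatAt`, a `finsum` — `0` by convention on an infinite
  support, which cannot occur for `L(·, ψ)` away from `s = 1`) and
  `ConreyIwaniec2020.dyadicSimpleCriticalZeroCount L T` (ordinates `t ∈ (T, 2T]` at which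
  `analyticOrderNatAt L (½ + it) = 1`, an `ncard`).
* (2.2) is an `O`-EQUALITY; since `N₀₀(T) ≤ N(T)` trivially, its content is the LOWER bound
  `N(T) ≤ N₀₀(T) + C·(T log|D| + (L(1,χ) log T)^{1/4} T log T)` with ONE absolute `C`, which is what
  is typed (`∃ C` outermost, before `K`, `κ`, `ψ`, `T`). Range of `T`: the paper states (2.2) without a
  range («holds trivially» below `Q^{3200}` against the `T log|D|` term); we take `T ≥ 2` so that
  `log T > 0` and the real power `(·)^{1/4}` is of a nonnegative base.
* Not typed here: (2.3) and Corollaries 2.3/2.4 (they follow from (2.2) and `N(T) ≍ T log(QT)`), the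
  general "`ε`-lacunary" hypothesis (1.5) (only the class-group case is proved in print: «It seems
  possible to show …», §2), and the `L(s, χ′)L(s, χχ′)` extension («extend easily», not carried out).

## References

* J. B. Conrey, H. Iwaniec, Acta Arith. 195 (2020) 217–268, arXiv:1607.03288: Def. 1.1, §2
  Thm. 2.1, Def. 2.2, Cor. 2.3–2.4, §12 (12.1). [ConreyIwaniec2020]
* J. B. Conrey, H. Iwaniec, Acta Arith. 103 (2002) 259–312 (the companion file
  `ConreyIwaniec2002.lean`). [ConreyIwaniec2002]
-/

noncomputable section

open Complex Set Filter
open scoped NumberField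

namespace Literature.NumberTheory.LFunctions

namespace ConreyIwaniec2020

/-! ### Counting vocabulary (§2) -/

/-- `N(T)` of §2: the number of zeros `ρ = β + iγ` of `L` with `0 < β < 1` and `γ ∼ T`, i.e.
`T < γ ≤ 2T`, counted with multiplicity (`analyticOrderNatAt`; a `finsum`, `0` by convention on an
infinite support). [cite: ConreyIwaniec2020, §2 (before Thm 2.1)] -/
def dyadicZeroCount (L : ℂ → ℂ) (T : ℝ) : ℕ :=
  ∑ᶠ s ∈ {s : ℂ | L s = 0 ∧ 0 < s.re ∧ s.re < 1 ∧ T < s.im ∧ s.im ≤ 2 * T}, analyticOrderNatAt L s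

/-- `N₀₀(T)` of Theorem 2.1: the number of SIMPLE zeros `ρ = ½ + iγ` of `L` with `T < γ ≤ 2T`
(ordinates `t` at which the analytic order of `L` at `½ + it` is exactly `1`; an `ncard`, `0` by
convention on an infinite set). [cite: ConreyIwaniec2020, §2 Thm 2.1] -/
def dyadicSimpleCriticalZeroCount (L : ℂ → ℂ) (T : ℝ) : ℕ :=
  {t : ℝ | T < t ∧ t ≤ 2 * T ∧ analyticOrderNatAt L (1 / 2 + t * I) = 1}.ncard

/-- The paper's "`ε`-exceptional" character (Definition 1.1): `L(1, χ) log|D| ≤ ε`, for a Dirichlet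
character `κ` (the Kronecker character mod `|D|`) and a discriminant `D`; `L(1, χ)` is rendered as
`‖L(1, κ)‖`. [cite: ConreyIwaniec2020, Def. 1.1] -/
def IsEpsExceptional {M : ℕ} [NeZero M] (κ : DirichletCharacter ℂ M) (D : ℤ) (ε : ℝ) : Prop :=
  ‖κ.LFunction 1‖ * Real.log |(D : ℝ)| ≤ ε

/-- Unfolding lemma for `IsEpsExceptional`. [cite: ConreyIwaniec2020, Def. 1.1] -/
theorem isEpsExceptional_iff {M : ℕ} [NeZero M] (κ : DirichletCharacter ℂ M) (D : ℤ) (ε : ℝ) :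
    IsEpsExceptional κ D ε ↔ ‖κ.LFunction 1‖ * Real.log |(D : ℝ)| ≤ ε := Iff.rfl

/-- `ε`-exceptional is monotone in `ε`. [cite: ConreyIwaniec2020, Def. 1.1] -/
theorem IsEpsExceptional.mono {M : ℕ} [NeZero M] {κ : DirichletCharacter ℂ M} {D : ℤ} {ε ε' : ℝ}
    (h : IsEpsExceptional κ D ε) (hε : ε ≤ ε') : IsEpsExceptional κ D ε' :=
  le_trans h hε

/-- A function with no zeros in the box has `N(T) = 0` (API for the §2 counting function).
[cite: ConreyIwaniec2020, §2 (before Thm 2.1)] -/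
theorem dyadicZeroCount_eq_zero_of_ne_zero {L : ℂ → ℂ} {T : ℝ}
    (h : ∀ s : ℂ, 0 < s.re → s.re < 1 → T < s.im → s.im ≤ 2 * T → L s ≠ 0) :
    dyadicZeroCount L T = 0 := by
  have hS : {s : ℂ | L s = 0 ∧ 0 < s.re ∧ s.re < 1 ∧ T < s.im ∧ s.im ≤ 2 * T} = ∅ := by
    ext s
    simp only [mem_setOf_eq, mem_empty_iff_false, iff_false, not_and]
    intro h0 h1 h2 h3 h4
    exact h s h1 h2 h3 h4 h0
  rw [dyadicZeroCount, hS, finsum_mem_empty]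

/-- If `L` vanishes nowhere on the critical segment `T < t ≤ 2T`, then `N₀₀(T) = 0` (API for the
counting function of Thm 2.1). [cite: ConreyIwaniec2020, §2 Thm 2.1] -/
theorem dyadicSimpleCriticalZeroCount_eq_zero_of_ne_zero {L : ℂ → ℂ} {T : ℝ}
    (h : ∀ t : ℝ, T < t → t ≤ 2 * T → L (1 / 2 + t * I) ≠ 0) :
    dyadicSimpleCriticalZeroCount L T = 0 := by
  have hS : {t : ℝ | T < t ∧ t ≤ 2 * T ∧ analyticOrderNatAt L (1 / 2 + t * I) = 1} = ∅ := by
    ext t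
    simp only [mem_setOf_eq, mem_empty_iff_false, iff_false, not_and]
    intro h1 h2 h3
    have hne := h t h1 h2
    by_cases ha : AnalyticAt ℂ L (1 / 2 + t * I)
    · have h0 : analyticOrderNatAt L (1 / 2 + t * I) = 0 := by
        rw [analyticOrderNatAt, (ha.analyticOrderAt_eq_zero).mpr hne]
        rfl
      omega
    · rw [analyticOrderNatAt_of_not_analyticAt ha] at h3
      exact absurd h3 (by norm_num)
  rw [dyadicSimpleCriticalZeroCount, hS, ncard_empty]

end ConreyIwaniec2020

open ConreyIwaniec2020 NumberField

/-- **Conrey–Iwaniec 2020, Theorem 2.1** (critical simple zeros of the class group `L`-functions of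
a quadratic field; unconditional, absolute constant). There is an absolute constant `C` such that
for every quadratic field `K` (`[K : ℚ] = 2`, discriminant `D = d_K` of either sign), with Kronecker
character `κ` modulo `|D|` (the Dirichlet character `κ ≠ 1` with `ζ_K(s) = ζ(s) L(s, κ)` on
`Re s > 1`), every class group character `ψ ∈ Ĉl(K)` and every `T ≥ 2`:
`N(T) ≤ N₀₀(T) + C · (T log|D| + (L(1, κ) log T)^{1/4} T log T)`,
where `N(T)` counts the zeros `β + iγ` of `L(s, ψ)` with `0 < β < 1`, `T < γ ≤ 2T` (with
multiplicity) and `N₀₀(T)` the simple zeros `½ + iγ`, `T < γ ≤ 2T` — i.e. the printed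
`N₀₀(T) = N(T) + O(T log|D| + (L(1,χ) log T)^{1/4} T log T)` with absolute implied constant (the
reverse inequality `N₀₀ ≤ N` being trivial). Levinson–Conrey method with a mollifier of length
`T^{1/400}`; "lacunarity" of `λ = 1 ⋆ χ` when `L(1, χ) log|D|` is small.
[cite: ConreyIwaniec2020, §2 Thm 2.1 (2.2); §12 (12.1)] -/
def conreyIwaniec2020_theorem21 : Prop :=
  ∃ C : ℝ, ∀ (K : Type) [Field K] [NumberField K], Module.finrank ℚ K = 2 →
    ∀ (M : ℕ) [NeZero M] (κ : DirichletCharacter ℂ M),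
      M = (NumberField.discr K).natAbs → κ ≠ 1 →
      (∀ s : ℂ, 1 < s.re →
        NumberField.dedekindZeta K s = riemannZeta s * LSeries (fun n ↦ κ n) s) →
    ∀ (ψ : ClassGroup (𝓞 K) →* ℂˣ) (T : ℝ), 2 ≤ T →
      (dyadicZeroCount (classGroupLFunction K ψ) T : ℝ) ≤
        dyadicSimpleCriticalZeroCount (classGroupLFunction K ψ) T +
          C * (T * Real.log M +
            (‖κ.LFunction 1‖ * Real.log T) ^ (1 / 4 : ℝ) * T * Real.log T)

end Literature.NumberTheory.LFunctions
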